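import Summits.CriticalPhenomena.PercolationContinuityZ3.Theorems.Transplant.FKConnectivityAllQAntipodalTwoSpineRuleR2Inj
import Summits.CriticalPhenomena.PercolationContinuityZ3.Theorems.Transplant.FKConnectivityAllQAntipodalTwoSpineMono
import Summits.CriticalPhenomena.PercolationContinuityZ3.Theorems.Transplant.FKConnectivityAllQAntipodalTwoSpineRuleCells
import Summits.CriticalPhenomena.PercolationContinuityZ3.Theorems.Transplant.FKConnectivityAllQAntipodalTwoSpineSumLemma
import HarnessLib

/-!
# Connectivity correlation inequalities for `φ_{w,q}` — TWO-SPINE word model: the RULE THEOREM (the root word inequality for ALL shapes)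

Helper file (`--supports stmt-CriticalPhenomena-4575`), FK sub-lane `prim-bschramm-fk-2` (gen 16); builds on p205010 (kernel theorem,
internal audit signed; external expert review pending).  No named facts, no sorries, standard axioms.

Memo `bschramm/FROM-fk-2-g15-TWO-SPINE.md` §11–12 and blueprint `prim-bschramm-fk-2-g15/BLUEPRINT-U11-LEAN.md` L2.  **`FK.TwoSpine.dstmt_root_W`**:
for `0 ≤ q ≤ 1` and EVERY pair of spine shapes `(oA, oB)`, the root diagram statement `DStmt q .W ⟨[((o,o,o,o),0)],[]⟩ oA oB` holds —
the series-top two-spine word inequality `∑_{(u,v)} Θ(u,v) · S(u,v) ≥ 0` for every admissible (nonnegative, flip-monotone) family `S`.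
By gen 15's two-spine reduction (memo §1; Lean bridge W3 to follow) this is Conjecture U¹¹ (`FK.apUpcSplit ≥ 0`) at a SERIES split
node for all two-terminal series–parallel networks with these spine shapes.  PROOF = gen 15's explicit certificate RULE, assembled:
the root sum is a signed sum over cells and atoms (`…TwoSpineRuleCells`); (R1) NON-CRITICAL loser cells (neither top-down run reaches
its root) are moved WHOLE by Theorem U's injection at the split node `ruleWhole = Φ_N` (`…TwoSpineRuleR1`: winner, side weights
preserved, letters raised; injective by `…TwoSpinePhiInj`); (R2) CRITICAL loser cells (absent-root side ground) are moved ATOM BY ATOM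
by `ruleAtom` = (Theorem U on `A∖y` for degree-0 atoms | gen 13's word-Hall `ι` for degree-1 atoms) ⊗ row exchange of the ground side ⊗
Janus flip (`…TwoSpineRuleR2/R2Inj`: winners, slots, `baseExp` preserved, raised, injective); (V3) atom targets have an anti-ground side
next to a present root, so they are never whole targets (`…TwoSpineNoCollision`); the summation lemma `…TwoSpineSumLemma` concludes.
Machine mirror: `explore/rule_check.py` of gen 15 (0 defects on all shape pairs `K_A + K_B ≤ 7`).
[cite: Grimmett2006, §3.8 (pp. 61–62); §3.9 (p. 63)]
-/

noncomputable section

namespace Summit.CriticalPhenomena.PercolationContinuityZ3.Theorems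

namespace FK

namespace TwoSpine

open X2Word

/-! ### The rule as maps on cells and pieces -/

/-- Decidable equality of cells (the nested product instance, assembled in two steps for the instance synthesizer). [folklore] -/
instance instDecidableEqCell : DecidableEq Cell :=
  haveI : DecidableEq (List SLetter × List SLetter) := inferInstance
  inferInstance

/-- A cell is NON-CRITICAL: neither side's top-down run reaches its root (memo §11 (R1)). [folklore] -/
def nonCritical (c : Cell) : Bool := !phiReachesRoot (rootA c.2) c.1.1 && !phiReachesRoot (rootB c.2) c.1.2

/-- **(R1)** the WHOLE move: Theorem U's injection at the split node, `Φ_N` (run each `01`-side; Janus kept). [folklore] -/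
def ruleWhole (c : Cell) : Cell := ((phiSide (rootA c.2) c.1.1, phiSide (rootB c.2) c.1.2), c.2)

/-- **(R2)** the ATOM move of a critical cell: on the present-root side Theorem U on `A∖y` (degree-0 atoms) or gen 13's `ι` (degree-1
atoms), row exchange of the ground side, Janus flipped; the atom label is kept. [folklore] -/
def ruleAtom (p : Cell × (Bool × Bool)) : Cell × (Bool × Bool) :=
  if p.1.2 then (((if p.2.1 then tgtA1 p.1.1.1 else tgtA0 p.1.1.1, p.1.1.2.map swapLetter), false), p.2)
  else (((p.1.1.1.map swapLetter, if p.2.2 then tgtA1 p.1.1.2 else tgtA0 p.1.1.2), true), p.2)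

/-! ### Loser cells: side types and criticality -/

/-- A LOSER cell: both complements conduct, not both sides conduct (in terms of the side types). [folklore] -/
theorem loser_topComp {j : Bool} {u v : List SLetter} (hl : cellSign j u v = -1) :
    (topComp (rootA j) u).2 = true ∧ (topComp (rootB j) v).2 = true ∧
      ¬ ((topComp (rootA j) u).1 = true ∧ (topComp (rootB j) v).1 = true) := by
  rw [cellSign_eq_topComp, bR_sign_eq_neg_one] at hl
  exact hl

/-- `-1 = -bR b` forces `b = true`. [folklore] -/
theorem eq_true_of_neg_bR {b : Bool} (h : (-1 : ℝ) = -bR b) : b = true := by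
  cases b
  · norm_num [bR] at h
  · rfl

/-- **A critical `j = true` loser has a GROUND `B`-word and a conducting `ᾱ`** (the run from the absent root `z` reaches it iff `v` is
ground, `phiReachesRoot_absent_iff`; the present root `y` is never reached). [folklore] -/
theorem critical_true {u v : List SLetter} (hl : cellSign true u v = -1) (hn : nonCritical ((u, v), true) = false) :
    isGround v = true ∧ rowC (sRowB u) = true := by
  have hA : phiReachesRoot (rootA true) u = false := phiReachesRoot_present u
  have hB : phiReachesRoot (false, true) v = true := by
    have h : (!phiReachesRoot (rootA true) u && !phiReachesRoot (rootB true) v) = false := hn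
    rw [hA] at h
    simpa [rootB] using h
  have hg : isGround v = true := by rw [← phiReachesRoot_absent_iff]; exact hB
  refine ⟨hg, eq_true_of_neg_bR ?_⟩
  rw [← cellSign_true_ground hg u, hl]

/-- **A critical `j = false` loser has a GROUND `A`-word and a conducting `β̄`.** [folklore] -/
theorem critical_false {u v : List SLetter} (hl : cellSign false u v = -1) (hn : nonCritical ((u, v), false) = false) :
    isGround u = true ∧ rowC (sRowB v) = true := by
  have hB : phiReachesRoot (rootB false) v = false := phiReachesRoot_present v
  have hA : phiReachesRoot (false, true) u = true := by
    have h : (!phiReachesRoot (rootA false) u && !phiReachesRoot (rootB false) v) = false := hn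
    rw [hB] at h
    simpa [rootA] using h
  have hg : isGround u = true := by rw [← phiReachesRoot_absent_iff]; exact hA
  refine ⟨hg, eq_true_of_neg_bR ?_⟩
  rw [← cellSign_false_groundA hg v, hl]

/-- Unfolding `nonCritical = true`. [folklore] -/
theorem nonCritical_iff {c : Cell} :
    nonCritical c = true ↔ phiReachesRoot (rootA c.2) c.1.1 = false ∧ phiReachesRoot (rootB c.2) c.1.2 = false := by
  simp [nonCritical]

/-! ### (R1): the whole move -/

/-- The cell weight (the sum of its atoms) is `q^{sideWeight_A + sideWeight_B}`. [folklore] -/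
theorem sum_atoms_eq_pow_sideWeight (q : ℝ) (c : Cell) :
    ∑ ab ∈ atoms c, atomW q c ab = q ^ (sideWeight (rootA c.2) c.1.1 + sideWeight (rootB c.2) c.1.2) := by
  rw [sum_atoms_atomW, ← pow_add]
  have h := baseExp_add_two c.2 c.1.1 c.1.2
  have h₁ := cellDelA_le_one c.2 c.1.1
  have h₂ := cellDelB_le_one c.2 c.1.2
  congr 1
  omega

/-- **(R1) is a valid whole move**: a non-critical loser goes to a winner cell of the same shapes. [folklore] -/
theorem ruleWhole_mem {oA oB : List Kind} {c : Cell} (hc : c ∈ cells oA oB) (hl : cellSign c.2 c.1.1 c.1.2 = -1)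
    (hn : nonCritical c = true) :
    ruleWhole c ∈ cells oA oB ∧ cellSign (ruleWhole c).2 (ruleWhole c).1.1 (ruleWhole c).1.2 = 1 := by
  obtain ⟨hA, hB⟩ := nonCritical_iff.1 hn
  refine ⟨mem_cells_of_forall₂ hc c.2 (phiSide_forall₂ _ _) (phiSide_forall₂ _ _), ?_⟩
  exact cellSign_phiN hl hA hB

/-- One side of the whole move is injective on loser sides (type `·1`, run not reaching the root). [folklore] -/
theorem phiSide_inj {r : Bool × Bool} {w₁ w₂ : List SLetter} (h₁ : (topComp r w₁).2 = true) (h₂ : (topComp r w₂).2 = true)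
    (n₁ : phiReachesRoot r w₁ = false) (n₂ : phiReachesRoot r w₂ = false) (heq : phiSide r w₁ = phiSide r w₂) : w₁ = w₂ := by
  unfold phiSide at heq
  by_cases t₁ : topComp r w₁ = (false, true) <;> by_cases t₂ : topComp r w₂ = (false, true)
  · rw [if_pos t₁, if_pos t₂] at heq
    exact phiRun_injective t₁ n₁ t₂ n₂ heq
  · rw [if_pos t₁, if_neg t₂] at heq
    have h := topComp_phiRun t₁ n₁
    rw [heq] at h
    rw [h] at h₂
    exact absurd h₂ (by simp)
  · rw [if_neg t₁, if_pos t₂] at heq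
    have h := topComp_phiRun t₂ n₂
    rw [← heq] at h
    rw [h] at h₁
    exact absurd h₁ (by simp)
  · rwa [if_neg t₁, if_neg t₂] at heq

/-- **(R1) is injective on non-critical losers.** [folklore] -/
theorem ruleWhole_inj {c₁ c₂ : Cell} (hl₁ : cellSign c₁.2 c₁.1.1 c₁.1.2 = -1) (hn₁ : nonCritical c₁ = true)
    (hl₂ : cellSign c₂.2 c₂.1.1 c₂.1.2 = -1) (hn₂ : nonCritical c₂ = true) (heq : ruleWhole c₁ = ruleWhole c₂) : c₁ = c₂ := by
  obtain ⟨⟨u₁, v₁⟩, j₁⟩ := c₁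
  obtain ⟨⟨u₂, v₂⟩, j₂⟩ := c₂
  simp only [ruleWhole, Prod.mk.injEq] at heq
  obtain ⟨⟨hu, hv⟩, hj⟩ := heq
  subst hj
  obtain ⟨a₁, b₁, -⟩ := loser_topComp hl₁
  obtain ⟨a₂, b₂, -⟩ := loser_topComp hl₂
  obtain ⟨nA₁, nB₁⟩ := nonCritical_iff.1 hn₁
  obtain ⟨nA₂, nB₂⟩ := nonCritical_iff.1 hn₂
  simp only at a₁ b₁ a₂ b₂ nA₁ nB₁ nA₂ nB₂ hu hv
  rw [phiSide_inj a₁ a₂ nA₁ nA₂ hu, phiSide_inj b₁ b₂ nB₁ nB₂ hv]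

/-- **(R1) preserves the cell weight** (Theorem U's injection preserves each side weight). [folklore] -/
theorem sum_atoms_ruleWhole (q : ℝ) {c : Cell} (hn : nonCritical c = true) :
    ∑ ab ∈ atoms (ruleWhole c), atomW q (ruleWhole c) ab = ∑ ab ∈ atoms c, atomW q c ab := by
  obtain ⟨hA, hB⟩ := nonCritical_iff.1 hn
  rw [sum_atoms_eq_pow_sideWeight, sum_atoms_eq_pow_sideWeight]
  simp only [ruleWhole]
  rw [sideWeight_phiSide hA, sideWeight_phiSide hB]

/-! ### (R2): the atom moves -/

/-- The row exchange of a ground word is anti-ground. [folklore] -/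
theorem isAntiGround_map_swapLetter {v : List SLetter} (hv : isGround v = true) : isAntiGround (v.map swapLetter) = true := by
  rw [← swap01_eq_swapLetter_of_ground hv]; exact isAntiGround_swap_of_ground hv

/-- **(V3) no collision**: a side run from a PRESENT root (identity on non-`01` sides) with conducting complement never produces an
anti-ground word — so an atom target (anti-ground side next to the present root) is never a whole target. [folklore] -/
theorem phiSide_present_ne_of_antiGround {v' w : List SLetter} (hanti : isAntiGround v' = true)
    (h2 : (topComp (true, false) w).2 = true) : phiSide (true, false) w ≠ v' := by
  intro heq
  unfold phiSide at heq
  by_cases t : topComp (true, false) w = (false, true)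
  · rw [if_pos t] at heq
    by_cases hw : w = v'
    · subst hw
      rw [topComp_present_antiGround hanti] at t
      exact absurd t (by simp)
    · exact phiRun_present_ne_of_lt_antiGround hanti (heq ▸ phiRun_forall₂ (true, false) w) hw heq
  · rw [if_neg t] at heq
    subst heq
    rw [topComp_present_antiGround hanti] at h2
    exact absurd h2 (by simp)

/-- The present-side target of an atom of label bit `a`: Theorem U on `A∖y` (`a = false`) or `ι` (`a = true`); it conducts in its
`γ`-row, keeps the total `corr`, lies above the word, and has the degree-1 slot when `a = true`. [folklore] -/
theorem tgt_spec {u : List SLetter} (a : Bool) (hab : rowC (sRowB u) = true) (hd : a = true → rowDel (sRowA u) = 1) :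
    rowC (sRowA (if a then tgtA1 u else tgtA0 u)) = true ∧
    rowCorr (sRowA (if a then tgtA1 u else tgtA0 u)) + rowCorr (sRowB (if a then tgtA1 u else tgtA0 u)) =
      rowCorr (sRowA u) + rowCorr (sRowB u) ∧
    List.Forall₂ (fun a b : SLetter => b = a ∨ (a.2 = (false, true) ∧ b = (a.1, true, false))) u (if a then tgtA1 u else tgtA0 u) ∧
    (a = true → rowDel (sRowB (if a then tgtA1 u else tgtA0 u)) = 1) := by
  cases a
  · obtain ⟨h1, h2, h3⟩ := tgtA0_spec hab
    exact ⟨h1, h2, h3, fun h => absurd h (by simp)⟩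
  · obtain ⟨h1, h2, h3, h4⟩ := tgtA1_spec hab (hd rfl)
    exact ⟨h1, h3, h4, fun _ => h2⟩

/-- **(R2) is a valid atom move, `j = true`** (present root `y` on `A`, ground `B`): the target cell has the same shapes, is a winner,
carries the atom slot, has the same `baseExp`, and both its words lie above the source's. [folklore] -/
theorem ruleAtom_true_spec {oA oB : List Kind} {u v : List SLetter} {a b : Bool} (hc : ((u, v), true) ∈ cells oA oB)
    (hl : cellSign true u v = -1) (hn : nonCritical ((u, v), true) = false) (hab : (a, b) ∈ atoms ((u, v), true)) :
    (((if a then tgtA1 u else tgtA0 u, v.map swapLetter), false) : Cell) ∈ cells oA oB ∧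
    cellSign false (if a then tgtA1 u else tgtA0 u) (v.map swapLetter) = 1 ∧
    (a, b) ∈ atoms (((if a then tgtA1 u else tgtA0 u, v.map swapLetter), false) : Cell) ∧
    baseExp (Mode.o, Mode.o, Mode.o, Mode.o) (if a then tgtA1 u else tgtA0 u) (v.map swapLetter) =
      baseExp (Mode.o, Mode.o, Mode.o, Mode.o) u v ∧
    List.Forall₂ (fun a b : SLetter => b = a ∨ (a.2 = (false, true) ∧ b = (a.1, true, false))) u (if a then tgtA1 u else tgtA0 u) ∧
    List.Forall₂ (fun a b : SLetter => b = a ∨ (a.2 = (false, true) ∧ b = (a.1, true, false))) v (v.map swapLetter) := by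
  obtain ⟨hv, hbb⟩ := critical_true hl hn
  rw [mem_atoms] at hab
  simp only at hab
  have hd : a = true → rowDel (sRowA u) = 1 := fun ha => by simpa [cellDelA] using hab.1 ha
  obtain ⟨t1, t2, t3, t4⟩ := tgt_spec a hbb hd
  refine ⟨mem_cells_of_forall₂ hc false t3 (forall₂_swap_of_ground hv), ?_, ?_, ?_, t3, forall₂_swap_of_ground hv⟩
  · rw [cellSign_false_swap_ground hv, t1]; simp [bR]
  · rw [mem_atoms]
    simp only
    refine ⟨fun ha => by simpa [cellDelA] using t4 ha, fun hb => ?_⟩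
    rw [cellDelB_swap]; exact hab.2 hb
  · rw [baseExp_root, baseExp_root]
    have h2 := rowCorr_swap v
    omega

/-- **(R2) is a valid atom move, `j = false`** (present root `z` on `B`, ground `A`). [folklore] -/
theorem ruleAtom_false_spec {oA oB : List Kind} {u v : List SLetter} {a b : Bool} (hc : ((u, v), false) ∈ cells oA oB)
    (hl : cellSign false u v = -1) (hn : nonCritical ((u, v), false) = false) (hab : (a, b) ∈ atoms ((u, v), false)) :
    (((u.map swapLetter, if b then tgtA1 v else tgtA0 v), true) : Cell) ∈ cells oA oB ∧
    cellSign true (u.map swapLetter) (if b then tgtA1 v else tgtA0 v) = 1 ∧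
    (a, b) ∈ atoms (((u.map swapLetter, if b then tgtA1 v else tgtA0 v), true) : Cell) ∧
    baseExp (Mode.o, Mode.o, Mode.o, Mode.o) (u.map swapLetter) (if b then tgtA1 v else tgtA0 v) =
      baseExp (Mode.o, Mode.o, Mode.o, Mode.o) u v ∧
    List.Forall₂ (fun a b : SLetter => b = a ∨ (a.2 = (false, true) ∧ b = (a.1, true, false))) u (u.map swapLetter) ∧
    List.Forall₂ (fun a b : SLetter => b = a ∨ (a.2 = (false, true) ∧ b = (a.1, true, false))) v (if b then tgtA1 v else tgtA0 v) := by
  obtain ⟨hu, hbb⟩ := critical_false hl hn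
  rw [mem_atoms] at hab
  simp only at hab
  have hd : b = true → rowDel (sRowA v) = 1 := fun hb => by simpa [cellDelB] using hab.2 hb
  obtain ⟨t1, t2, t3, t4⟩ := tgt_spec b hbb hd
  refine ⟨mem_cells_of_forall₂ hc true (forall₂_swap_of_ground hu) t3, ?_, ?_, ?_, forall₂_swap_of_ground hu, t3⟩
  · rw [cellSign_true_swap_groundA hu, t1]; simp [bR]
  · rw [mem_atoms]
    simp only
    refine ⟨fun ha => ?_, fun hb => by simpa [cellDelB] using t4 hb⟩
    rw [cellDelA_swap]; exact hab.1 ha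
  · rw [baseExp_root, baseExp_root]
    have h2 := rowCorr_swap u
    omega

/-- The present-side target map is injective on critical-loser words (for a fixed label bit). [folklore] -/
theorem tgt_inj {u₁ u₂ : List SLetter} (a : Bool) (h₁ : rowC (sRowB u₁) = true) (h₂ : rowC (sRowB u₂) = true)
    (d₁ : a = true → rowDel (sRowA u₁) = 1) (d₂ : a = true → rowDel (sRowA u₂) = 1)
    (h : (if a then tgtA1 u₁ else tgtA0 u₁) = (if a then tgtA1 u₂ else tgtA0 u₂)) : u₁ = u₂ := by
  cases a
  · exact tgtA0_injective h₁ h₂ (by simpa using h)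
  · exact tgtA1_injective h₁ (d₁ rfl) h₂ (d₂ rfl) (by simpa using h)

/-! ### The rule theorem -/

/-- **THE RULE THEOREM — the root two-spine word inequality for ALL shapes** (memo g15 §11–12): for `0 ≤ q ≤ 1` and every pair of
spine shapes, `DStmt q .W ⟨[((o,o,o,o),0)],[]⟩ oA oB` — `∑_{(u,v)} Θ(u,v) S(u,v) ≥ 0` for every admissible family `S`.  With gen 15's
two-spine reduction this is Conjecture U¹¹ (`FK.apUpcSplit ≥ 0`) at every SERIES split node. [cite: Grimmett2006, §3.9 (p. 63)] -/
theorem dstmt_root_W {q : ℝ} (hq0 : 0 ≤ q) (hq1 : q ≤ 1) (oA oB : List Kind) :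
    DStmt q .W ⟨[((Mode.o, Mode.o, Mode.o, Mode.o), 0)], []⟩ oA oB := by
  intro S hS
  rw [dsum_root_eq_sum_cells]
  have hflip : ∀ (c : Cell) {u' v' : List SLetter},
      List.Forall₂ (fun a b : SLetter => b = a ∨ (a.2 = (false, true) ∧ b = (a.1, true, false))) c.1.1 u' →
      List.Forall₂ (fun a b : SLetter => b = a ∨ (a.2 = (false, true) ∧ b = (a.1, true, false))) c.1.2 v' →
      S 0 c.1.1 c.1.2 ≤ S 0 u' v' := fun c _ _ hu hv => hS.le_of_forall₂ 0 hu hv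
  refine sum_sign_nonneg_of_matching (cells oA oB) atoms (fun c => cellSign c.2 c.1.1 c.1.2) (atomW q)
    (fun c => S 0 c.1.1 c.1.2) (fun c _ => cellSign_mem _ _ _) (fun c ab _ => atomW_nonneg hq0 hq1 c ab)
    (fun c => hS.nonneg 0 _ _)
    (((cells oA oB).filter fun c => cellSign c.2 c.1.1 c.1.2 = -1).filter fun c => nonCritical c = true)
    (Finset.filter_subset _ _) ruleWhole ?_ ?_ ?_ ruleAtom ?_ ?_ ?_
  · -- (R1) lands on winners of the same shapes
    intro c hc
    obtain ⟨hc, hn⟩ := Finset.mem_filter.1 hc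
    obtain ⟨hc, hl⟩ := Finset.mem_filter.1 hc
    exact ruleWhole_mem hc hl hn
  · -- (R1) injective
    intro c₁ hc₁ c₂ hc₂ heq
    obtain ⟨hc₁, hn₁⟩ := Finset.mem_filter.1 hc₁
    obtain ⟨-, hl₁⟩ := Finset.mem_filter.1 hc₁
    obtain ⟨hc₂, hn₂⟩ := Finset.mem_filter.1 hc₂
    obtain ⟨-, hl₂⟩ := Finset.mem_filter.1 hc₂
    exact ruleWhole_inj hl₁ hn₁ hl₂ hn₂ heq
  · -- (R1) does not lose mass
    intro c hc
    obtain ⟨-, hn⟩ := Finset.mem_filter.1 hc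
    rw [sum_atoms_ruleWhole q hn]
    refine mul_le_mul_of_nonneg_left ?_ (Finset.sum_nonneg fun ab _ => atomW_nonneg hq0 hq1 c ab)
    exact hflip c (phiSide_forall₂ _ _) (phiSide_forall₂ _ _)
  · -- (R2) lands on atom slots of winners of the same shapes, never on whole targets
    intro p hp
    obtain ⟨hpc, hab⟩ := mem_pieces.1 hp
    obtain ⟨hcL, hcD⟩ := Finset.mem_sdiff.1 hpc
    obtain ⟨hcC, hl⟩ := Finset.mem_filter.1 hcL
    have hn : nonCritical p.1 = false := by
      simpa using (fun h => hcD (Finset.mem_filter.2 ⟨hcL, h⟩) : ¬ nonCritical p.1 = true)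
    obtain ⟨⟨⟨u, v⟩, j⟩, ⟨a, b⟩⟩ := p
    simp only at hcC hl hn hab ⊢
    -- no collision with a whole target
    have notWhole : ∀ (c'' : Cell), c'' ∈ ((cells oA oB).filter fun c => cellSign c.2 c.1.1 c.1.2 = -1).filter
        (fun c => nonCritical c = true) → ∀ (w₁ w₂ : List SLetter) (j' : Bool), ruleWhole c'' = ((w₁, w₂), j') →
        (j' = false → ∀ v₀, isGround v₀ = true → w₂ ≠ v₀.map swapLetter) ∧
        (j' = true → ∀ u₀, isGround u₀ = true → w₁ ≠ u₀.map swapLetter) := by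
      intro c'' hc'' w₁ w₂ j' heq
      obtain ⟨hc'', -⟩ := Finset.mem_filter.1 hc''
      obtain ⟨-, hl''⟩ := Finset.mem_filter.1 hc''
      obtain ⟨⟨u'', v''⟩, j''⟩ := c''
      simp only [ruleWhole, Prod.mk.injEq] at heq
      obtain ⟨⟨rfl, rfl⟩, rfl⟩ := heq
      obtain ⟨tA, tB, -⟩ := loser_topComp hl''
      constructor
      · rintro rfl v₀ hv₀
        exact phiSide_present_ne_of_antiGround (isAntiGround_map_swapLetter hv₀) tB
      · rintro rfl u₀ hu₀
        exact phiSide_present_ne_of_antiGround (isAntiGround_map_swapLetter hu₀) tA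
    cases j
    · obtain ⟨m1, m2, m3, -, -, -⟩ := ruleAtom_false_spec hcC hl hn hab
      refine ⟨by simpa [ruleAtom] using m1, by simpa [ruleAtom] using m2, by simpa [ruleAtom] using m3, ?_⟩
      intro himg
      obtain ⟨c'', hc'', heq⟩ := Finset.mem_image.1 himg
      simp only [ruleAtom, Bool.false_eq_true, if_false] at heq
      exact ((notWhole c'' hc'' _ _ _ heq).2 rfl u (critical_false hl hn).1) rfl
    · obtain ⟨m1, m2, m3, -, -, -⟩ := ruleAtom_true_spec hcC hl hn hab
      refine ⟨by simpa [ruleAtom] using m1, by simpa [ruleAtom] using m2, by simpa [ruleAtom] using m3, ?_⟩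
      intro himg
      obtain ⟨c'', hc'', heq⟩ := Finset.mem_image.1 himg
      simp only [ruleAtom, if_true] at heq
      exact ((notWhole c'' hc'' _ _ _ heq).1 rfl v (critical_true hl hn).1) rfl
  · -- (R2) injective on pieces
    intro p₁ hp₁ p₂ hp₂ heq
    have unpack : ∀ p ∈ pieces (((cells oA oB).filter fun c => cellSign c.2 c.1.1 c.1.2 = -1) \
        ((cells oA oB).filter fun c => cellSign c.2 c.1.1 c.1.2 = -1).filter fun c => nonCritical c = true) atoms,
        cellSign p.1.2 p.1.1.1 p.1.1.2 = -1 ∧ nonCritical p.1 = false ∧ p.2 ∈ atoms p.1 := by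
      intro p hp
      obtain ⟨hpc, hab⟩ := mem_pieces.1 hp
      obtain ⟨hcL, hcD⟩ := Finset.mem_sdiff.1 hpc
      obtain ⟨-, hl⟩ := Finset.mem_filter.1 hcL
      have hn : nonCritical p.1 = false := by
        simpa using (fun h => hcD (Finset.mem_filter.2 ⟨hcL, h⟩) : ¬ nonCritical p.1 = true)
      exact ⟨hl, hn, hab⟩
    obtain ⟨hl₁, hn₁, hab₁⟩ := unpack p₁ hp₁
    obtain ⟨hl₂, hn₂, hab₂⟩ := unpack p₂ hp₂
    obtain ⟨⟨⟨u₁, v₁⟩, j₁⟩, ⟨a₁, b₁⟩⟩ := p₁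
    obtain ⟨⟨⟨u₂, v₂⟩, j₂⟩, ⟨a₂, b₂⟩⟩ := p₂
    simp only at hl₁ hn₁ hab₁ hl₂ hn₂ hab₂
    rw [mem_atoms] at hab₁ hab₂
    simp only at hab₁ hab₂
    cases j₁ <;> cases j₂ <;> simp only [ruleAtom, Bool.false_eq_true, if_false, if_true, Prod.mk.injEq] at heq
    · obtain ⟨⟨⟨hu, hv⟩, -⟩, rfl, rfl⟩ := heq
      obtain ⟨-, hb₁⟩ := critical_false hl₁ hn₁
      obtain ⟨-, hb₂⟩ := critical_false hl₂ hn₂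
      rw [map_swapLetter_injective hu, tgt_inj b₁ hb₁ hb₂ (fun hb => by simpa [cellDelB] using hab₁.2 hb)
        (fun hb => by simpa [cellDelB] using hab₂.2 hb) hv]
    · exact absurd heq.1.2 (by simp)
    · exact absurd heq.1.2 (by simp)
    · obtain ⟨⟨⟨hu, hv⟩, -⟩, rfl, rfl⟩ := heq
      obtain ⟨-, ha₁⟩ := critical_true hl₁ hn₁
      obtain ⟨-, ha₂⟩ := critical_true hl₂ hn₂
      rw [map_swapLetter_injective hv, tgt_inj a₁ ha₁ ha₂ (fun ha => by simpa [cellDelA] using hab₁.1 ha)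
        (fun ha => by simpa [cellDelA] using hab₂.1 ha) hu]
  · -- (R2) moves each piece to a piece of equal weight and larger test value
    intro p hp
    obtain ⟨hpc, hab⟩ := mem_pieces.1 hp
    obtain ⟨hcL, hcD⟩ := Finset.mem_sdiff.1 hpc
    obtain ⟨hcC, hl⟩ := Finset.mem_filter.1 hcL
    have hn : nonCritical p.1 = false := by
      simpa using (fun h => hcD (Finset.mem_filter.2 ⟨hcL, h⟩) : ¬ nonCritical p.1 = true)
    obtain ⟨⟨⟨u, v⟩, j⟩, ⟨a, b⟩⟩ := p
    simp only at hcC hl hn hab ⊢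
    cases j
    · obtain ⟨-, -, -, m4, m5, m6⟩ := ruleAtom_false_spec hcC hl hn hab
      simp only [ruleAtom, Bool.false_eq_true, if_false, atomW]
      rw [m4]
      exact mul_le_mul_of_nonneg_left (hflip ((u, v), false) m5 m6) (atomW_nonneg hq0 hq1 ((u, v), false) (a, b))
    · obtain ⟨-, -, -, m4, m5, m6⟩ := ruleAtom_true_spec hcC hl hn hab
      simp only [ruleAtom, if_true, atomW]
      rw [m4]
      exact mul_le_mul_of_nonneg_left (hflip ((u, v), true) m5 m6) (atomW_nonneg hq0 hq1 ((u, v), true) (a, b))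

end TwoSpine

end FK

end Summit.CriticalPhenomena.PercolationContinuityZ3.Theorems

end
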